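import Summits.QuantumFields.YangMills.Theorems.BalabanUVNodesN16LeafSlot
import HarnessLib

/-!
# Route «BalabanUVNodes», cluster K4 «SpineRates» — node N16 = NE3: THE DISPLAYED LETTER LINES OF `LeafSlot` AND THE PROVISO `InEndRegime` ARE JOINTLY SATISFIABLE —
# at every family, period `Nper ≥ 1`, coupling letter `g > 0`, data `dom` and every choice of node N05's constants there are END letters IN THE REGIME OF RECORD at which
# the leaf-form slot REDUCES to its three content clauses (N05's `Thm4Body`, `Prop3Body`; N07's `LeafH3sup` at positive leaf letters) — an R422 vacuity guard + the
# letter recipe for the pin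

Cell `pub-ymgap`, seat `pub-ymgap-dag-n16-e` (R134 acceleration seat (a), strategy s2; HUMAN RULING D-0062; chair R424 venue), generation 2, file 10 (THEOREMS ONLY,
0 `def`, 0 `sorry`).  `bears_on: R4∕N16 · K3′ SpineGivenEndpointR12`.  Filed `--supports stmt-QuantumFields-19792 --as helper`.  Imports this seat's file 7
`BalabanUVNodesN16LeafSlot` (p466652: `LeafSlot`; through it file 1 `InEndRegime`, `radiusOfRecord`, `constOfRecord`, `radiusOfRecord_pos`, `constOfRecord_nonneg`, and
dag-n16-c's `N16.OfLeaf.exists_window_print`).  Restates nothing.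

WHY.  The knits `InEndRegime c → LeafSlot c → N16At c` (file 7) and `S_N16 RRec` at any keyed home (files 5 ∕ 6 ∕ 9) carry content only if the proviso and the slot's
≈ 30 displayed numeric lines can hold TOGETHER for some letters — in particular the slot wants `c.ε < α ≤ c₁′∕177` (N05's window) while the proviso wants
`0 < c.ε ≤ radiusOfRecord N F.L Nper` (THE END's radius): both are UPPER bounds, so a small class radius serves both, but the referees' A2 question («is the knit
vacuous?») deserves a kernel certificate.  THIS FILE gives it: for all inputs there are `ε, C, Λ₁, Λ₂′` (the bundle's letters, with `b = 0`) and POSITIVE leaf letters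
`b′, c′` such that `InEndRegime (ne3OfRecord₁₁ F ⟨Nper, ε, 0, g, C, Λ₁, Λ₂′, dom⟩)` holds AND `LeafSlot` of that bundle follows from the three content clauses ALONE
(`Thm4Body c₁ B₁′ …`, `Prop3Body cP 4 F.L C₂ inp B₀β …` on the univ sub-family of `zdGF3 (M_N ℂ) F.L 1 1`, `LeafH3sup 4 F.L Nper ε b′ c′ dom`).  Choices: the window
`c₁′` of `exists_window_print`; `α = min {c₁′∕177, r∕(1770·B + 1), c₂′(4,L)∕2, 1∕((M + 12)(1 + K_cur) + 1), 10⁻⁹}` with `r = radiusOfRecord`, `B = 5·4·L·B₀`,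
`M = 23040·4⁴·(frameC 4 L + 4)³`, `K_cur = curConst 4 L`; `b′ = c′ = α²`; `ε = α∕2`; `Λ₁ = r`; `Λ₂′ = B_h·177α + 8·X·(B·177α)` (`X = b′ + 226(8·5·8)²b′²`); `C = constOfRecord`;
`Mc = 0`, `𝒬 ≡ ∅`, `C₃₃₅ = 1`, `len ≡ 1`.

CONTENT.  `exists_letters_inEndRegime_leafSlot` [folklore].

HONEST FRAMING.  Elementary real arithmetic on OUR displayed lines; the three content clauses stay HYPOTHESES (N05's leaf modulo its sockets; N07's Thm 1 TYPE); nothing of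
Bałaban's asserted; **N16 ∕ NE3 NOT discharged**; count-neutral; one finite four-torus at fixed ε — NOT ℝ⁴, NOT infinite volume, NOT OS, NOT a mass gap, NOT Clay.
-/

set_option autoImplicit false

open scoped BigOperators Matrix Matrix.Norms.L2Operator
open NormedSpace

namespace Summit.QuantumFields.YangMills.BalabanUVNodes.N16LeafSlotLetters

open Literature.MathematicalPhysics.QuantumFieldTheory.Balaban1983to89
open Literature.MathematicalPhysics.QuantumFieldTheory.Balaban1983to89.T4Continuum (T4Family)
open B7Prop1Explicit B7Prop2Explicit
open B8LeafModelZd (ZdIdx)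
open B8LeafModelZd3 (zdGF3)
open Summit.QuantumFields.BalabanUV.T4Continuum
open BlockAverageCurrent (curConst curConst_nonneg)
open NE3RightInverseSupLetters (frameC)
open NE3.LeafIndexSockets (LeafH3sup)
open YMDAG.UVSplit (NE3Carriers ne3OfRecord₁₁)
open Summit.QuantumFields.YangMills.BalabanUVNodes.N16Regime (InEndRegime radiusOfRecord constOfRecord radiusOfRecord_pos constOfRecord_nonneg)
open Summit.QuantumFields.YangMills.BalabanUVNodes.N16AtRateRecord11 (inEndRegime_ne3Objects_iff)
open Summit.QuantumFields.YangMills.BalabanUVNodes.N16LeafSlot (LeafSlot)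
open Summit.QuantumFields.YangMills.BalabanUVNodes.N16.OfLeaf (exists_window_print)

noncomputable section

variable {N : ℕ} [NeZero N]

/-! ### Arithmetic helpers (tiny contexts, so that `nlinarith` stays cheap) -/

/-- `α² + K·α⁴ ≤ α²(1+K)` and `(α²)² ≤ α²` for `0 ≤ α ≤ 1`, `0 ≤ K`. [folklore] -/
private theorem sq_poly_le {α K : ℝ} (h0 : 0 ≤ α) (h1 : α ≤ 1) (hK : 0 ≤ K) :
    α ^ 2 + K * (α ^ 2) ^ 2 ≤ α ^ 2 * (1 + K) := by
  have h4 : (α ^ 2) ^ 2 ≤ α ^ 2 := by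
    have : α ^ 2 ≤ 1 := by nlinarith
    nlinarith [sq_nonneg α]
  nlinarith

/-- If `α·((M+12)(1+K)+1) ≤ 1` then `M·(α² + Kα⁴) ≤ 1` and `12·(α² + Kα⁴) < α` (`0 < α ≤ 1`, `0 ≤ M, K`). [folklore] -/
private theorem lines_of_small {α M K : ℝ} (h0 : 0 < α) (h1 : α ≤ 1) (hM : 0 ≤ M) (hK : 0 ≤ K) (h : α * ((M + 12) * (1 + K) + 1) ≤ 1) :
    M * (α ^ 2 + K * (α ^ 2) ^ 2) ≤ 1 ∧ 4 * ((4 : ℝ) - 1) * (α ^ 2 + K * (α ^ 2) ^ 2) < α := by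
  have hp := sq_poly_le h0.le h1 hK
  have hq : 0 ≤ α ^ 2 + K * (α ^ 2) ^ 2 := by positivity
  have hαM : α * (M * (1 + K)) ≤ 1 - α := by nlinarith
  have hα12 : α * (12 * (1 + K)) ≤ 1 - α := by nlinarith
  constructor
  · calc M * (α ^ 2 + K * (α ^ 2) ^ 2) ≤ M * (α ^ 2 * (1 + K)) := mul_le_mul_of_nonneg_left hp hM
      _ = α * (α * (M * (1 + K))) := by ring
      _ ≤ α * (1 - α) := mul_le_mul_of_nonneg_left hαM h0.le
      _ ≤ 1 := by nlinarith
  · calc 4 * ((4 : ℝ) - 1) * (α ^ 2 + K * (α ^ 2) ^ 2) ≤ 12 * (α ^ 2 * (1 + K)) := by nlinarith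
      _ = α * (α * (12 * (1 + K))) := by ring
      _ ≤ α * (1 - α) := mul_le_mul_of_nonneg_left hα12 h0.le
      _ < α := by nlinarith

/-- The (3.35) size `X = α² + C·α⁴` is below `α` once `α·(1 + C) < 1` (`0 < α ≤ 1`, `0 ≤ C`). [folklore] -/
private theorem size335_lt {α C : ℝ} (h0 : 0 < α) (h1 : α ≤ 1) (hC : 0 ≤ C) (h : α * (1 + C) < 1) :
    α ^ 2 + C * (α ^ 2) ^ 2 < α := by
  have hp := sq_poly_le h0.le h1 hC
  calc α ^ 2 + C * (α ^ 2) ^ 2 ≤ α ^ 2 * (1 + C) := hp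
    _ = α * (α * (1 + C)) := by ring
    _ < α * 1 := mul_lt_mul_of_pos_left h h0
    _ = α := mul_one α

/-- **THE PROVISO AND THE SLOT's LETTER LINES ARE JOINTLY SATISFIABLE; AT THE CHOSEN LETTERS THE SLOT IS ITS THREE CONTENT CLAUSES.**  For every family `F`, period
`Nper ≥ 1`, coupling letter `g > 0`, data `dom`, N05 constants `c₁, cP, B₁′ > 0`, `C₂`, `B₀β`, `inp` with `5·4·F.L·B₀ ≤ B₁′`: there are `ε, C, Λ₁, Λ₂′` and leaf letters
`b′, c′ > 0` with `InEndRegime (ne3OfRecord₁₁ F ⟨Nper, ε, 0, g, C, Λ₁, Λ₂′, dom⟩)` and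
`Thm4Body c₁ B₁′ (zdGF3|univ) → Prop3Body cP 4 F.L C₂ inp B₀β (zdGF3|univ) → LeafH3sup 4 F.L Nper ε b′ c′ dom → LeafSlot (ne3OfRecord₁₁ F ⟨Nper, ε, 0, g, C, Λ₁, Λ₂′, dom⟩)`. [folklore] -/
theorem exists_letters_inEndRegime_leafSlot (F : T4Family) {Nper : ℕ} (hN : 1 ≤ Nper) {g : ℝ} (hg : 0 < g)
    (dom : Set (Site 4 → Fin 4 → (Matrix (Fin N) (Fin N) ℂ)ˣ)) {c₁ cP B₁' : ℝ} (C₂ : ℝ) {B₀β : ℝ} (inp : B8.B9Inputs)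
    (hc₁ : 0 < c₁) (hcP : 0 < cP) (hB₁' : 0 < B₁') (hBB : 5 * ((4 : ℕ) : ℝ) * F.L * inp.B₀ ≤ B₁') :
    letI : CStarAlgebra (Matrix (Fin N) (Fin N) ℂ) := {}
    ∃ (ε C Λ₁ Λ₂' b' c' : ℝ), 0 < b' ∧ 0 < c' ∧
      InEndRegime (ne3OfRecord₁₁ F ⟨Nper, ε, 0, g, C, Λ₁, Λ₂', dom⟩) ∧
      (B8.Thm4Body c₁ B₁' (fun i : {i : ZdIdx 4 F.L // i.Ω 0 = Set.univ} => (zdGF3 (Matrix (Fin N) (Fin N) ℂ) F.L 1 (fun _ => 1) i.1).toGFData) →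
        B8.Prop3Body cP 4 (F.L : ℝ) C₂ inp B₀β
          (fun i : {i : ZdIdx 4 F.L // i.Ω 0 = Set.univ} => (zdGF3 (Matrix (Fin N) (Fin N) ℂ) F.L 1 (fun _ => 1) i.1).toGFData2) →
        LeafH3sup 4 F.L Nper ε b' c' dom →
        LeafSlot (ne3OfRecord₁₁ F ⟨Nper, ε, 0, g, C, Λ₁, Λ₂', dom⟩)) := by
  letI : CStarAlgebra (Matrix (Fin N) (Fin N) ℂ) := {}
  have hL : 2 ≤ F.L := HistoryFlow.two_le_L F
  have hL1 : 1 ≤ F.L := le_trans one_le_two hL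
  -- THE END's thresholds (opaque letters `r`, `Cof`)
  obtain ⟨r, hr_def, hr⟩ : ∃ r : ℝ, r = radiusOfRecord N F.L Nper ∧ 0 < r := ⟨_, rfl, radiusOfRecord_pos hL hN⟩
  have hCof : 0 ≤ constOfRecord N F.L Nper g := constOfRecord_nonneg hL hN hg
  -- N05's output constants and the window
  have hL0 : (0 : ℝ) < F.L := by exact_mod_cast lt_of_lt_of_le one_pos hL1
  have hB₀ := inp.B₀_pos
  obtain ⟨B, hB_def, hB0⟩ : ∃ B : ℝ, B = 5 * ((4 : ℕ) : ℝ) * F.L * inp.B₀ ∧ 0 < B := ⟨_, rfl, by positivity⟩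
  obtain ⟨Bh, hBh_def⟩ : ∃ Bh : ℝ, Bh = 5 * ((4 : ℕ) : ℝ) * F.L * B₀β := ⟨_, rfl⟩
  obtain ⟨c₁', hc₁', hwin⟩ := exists_window_print (d := 4) (L := F.L) (by norm_num) hL C₂ hc₁ hcP hB₁'
  have h16 : 16 * (B * c₁') ≤ 1 := by
    obtain ⟨-, -, -, h, -⟩ := hwin (c₁' / 2) (c₁' / 2) (by linarith) (by linarith) (by linarith)
    have h' : 16 * (B₁' * c₁') ≤ 1 := by rwa [add_halves] at h
    have hBB' : B ≤ B₁' := hB_def ▸ hBB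
    linarith only [h', mul_le_mul_of_nonneg_right hBB' hc₁'.le]
  -- the big constant of the frame line, the current constant, B7's `c₂′`
  obtain ⟨M, hM_def, hM0⟩ : ∃ M : ℝ, M = 23040 * (4 : ℝ) ^ 4 * (frameC 4 F.L + 4) ^ 3 ∧ 0 ≤ M :=
    ⟨_, rfl, by have : 0 ≤ frameC 4 F.L := by unfold frameC; positivity
                positivity⟩
  have hcur : 0 ≤ curConst 4 F.L := curConst_nonneg (d := 4) F.L
  have hc2 : 0 < c2' 4 F.L := c2'_pos 4 F.L hL1
  -- the averaging letter `α` (opaque, with its five upper bounds)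
  obtain ⟨α, hα, hα1, hα2, hα3, hα4, hα5⟩ : ∃ α : ℝ, 0 < α ∧ α ≤ c₁' / 177 ∧ α ≤ r / (1770 * B + 1) ∧ α ≤ c2' 4 F.L / 2 ∧
      α ≤ 1 / ((M + 12) * (1 + curConst 4 F.L) + 1) ∧ α ≤ 1 / 10 ^ 9 := by
    refine ⟨min (min (c₁' / 177) (r / (1770 * B + 1))) (min (c2' 4 F.L / 2) (min (1 / ((M + 12) * (1 + curConst 4 F.L) + 1)) (1 / 10 ^ 9))),
      lt_min (lt_min (by positivity) (by positivity)) (lt_min (by positivity) (lt_min (by positivity) (by norm_num))), ?_, ?_, ?_, ?_, ?_⟩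
    · exact (min_le_left _ _).trans (min_le_left _ _)
    · exact (min_le_left _ _).trans (min_le_right _ _)
    · exact (min_le_right _ _).trans (min_le_left _ _)
    · exact (min_le_right _ _).trans ((min_le_right _ _).trans (min_le_left _ _))
    · exact (min_le_right _ _).trans ((min_le_right _ _).trans (min_le_right _ _))
  have hα_le_one : α ≤ 1 := hα5.trans (by norm_num)
  have hαr : α ≤ r := hα2.trans (div_le_self hr.le (by linarith only [hB0]))
  -- the (3.35) size `X = α² + C₀·α⁴ < α`
  have hXα : α ^ 2 + 226 * (8 * ((4 : ℝ) + 1) * ((4 : ℝ) + 4)) ^ 2 * (α ^ 2) ^ 2 < α :=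
    size335_lt hα hα_le_one (by positivity) (by linarith only [hα5, hα])
  have hX0 : 0 ≤ α ^ 2 + 226 * (8 * ((4 : ℝ) + 1) * ((4 : ℝ) + 4)) ^ 2 * (α ^ 2) ^ 2 := by positivity
  have hXs : α ^ 2 + 226 * (8 * ((4 : ℝ) + 1) * ((4 : ℝ) + 4)) ^ 2 * (α ^ 2) ^ 2 ≤ 1 / 10 ^ 9 := hXα.le.trans hα5
  -- the frame line and the current line from `α·((M+12)(1+K_cur)+1) ≤ 1`
  have hden : 0 < (M + 12) * (1 + curConst 4 F.L) + 1 := by positivity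
  have hαK : α * ((M + 12) * (1 + curConst 4 F.L) + 1) ≤ 1 := by
    rw [le_div_iff₀ hden] at hα4; exact hα4
  obtain ⟨hcF', hY⟩ := lines_of_small hα hα_le_one hM0 hcur hαK
  have hcF : 23040 * (4 : ℝ) ^ 4 * (frameC 4 F.L + 4) ^ 3 * (α ^ 2 + curConst 4 F.L * (α ^ 2) ^ 2) ≤ 1 := hM_def ▸ hcF'
  -- the regularity line from `α ≤ c₂′∕2` and `α ≤ 10⁻⁹`
  have hRb : 2 ^ 15 * ((4 : ℝ) + 1) ^ 2 * ((4 : ℝ) + 4) ^ 2 * (F.L : ℝ) ^ 2 * α ^ 2 ≤ 1 := by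
    have hpos : (0 : ℝ) < (F.L : ℝ) ^ 2 := by positivity
    have hL2α : (F.L : ℝ) ^ 2 * α ≤ 1 / 40960 := by
      have e : c2' 4 F.L / 2 = (1 / 40960) / (F.L : ℝ) ^ 2 := by
        unfold c2'; push_cast; field_simp; ring
      rw [e, le_div_iff₀ hpos] at hα3
      linarith only [hα3]
    calc 2 ^ 15 * ((4 : ℝ) + 1) ^ 2 * ((4 : ℝ) + 4) ^ 2 * (F.L : ℝ) ^ 2 * α ^ 2
        = 52428800 * (((F.L : ℝ) ^ 2 * α) * α) := by ring
      _ ≤ 52428800 * ((1 / 40960) * (1 / 10 ^ 9)) :=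
          mul_le_mul_of_nonneg_left (mul_le_mul hL2α hα5 hα.le (by norm_num)) (by norm_num)
      _ ≤ 1 := by norm_num
  -- the α-lines
  have hA3 : C0 4 * α ≤ 1 / 3 := by unfold C0; push_cast; linarith only [hα5, hα]
  have hA2 : 2 * α ≤ c2' 4 F.L := by linarith only [hα3]
  have hAs : 11 * (4 : ℝ) ^ 2 * α ≤ 1 / 6 := by linarith only [hα5]
  have hAc : α + 11 * (4 : ℝ) ^ 2 * α ≤ c₁' := by
    rw [le_div_iff₀ (by norm_num : (0 : ℝ) < 177)] at hα1; linarith only [hα1]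
  -- the Λ-lines with `A = α + 11·16·α = 177·α`
  have hA0 : 0 ≤ α + 11 * (4 : ℝ) ^ 2 * α := by positivity
  have hBA : B * (α + 11 * (4 : ℝ) ^ 2 * α) ≤ r / 10 := by
    have hden' : 0 < 1770 * B + 1 := by positivity
    rw [le_div_iff₀ hden'] at hα2
    rw [le_div_iff₀ (by norm_num : (0 : ℝ) < 10)]
    have e : B * (α + 11 * (4 : ℝ) ^ 2 * α) * 10 = α * (1770 * B + 1) - α := by ring
    rw [e]; linarith only [hα2, hα]
  have hBA0 : 0 ≤ B * (α + 11 * (4 : ℝ) ^ 2 * α) := mul_nonneg hB0.le hA0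
  have hss : B * (α + 11 * (4 : ℝ) ^ 2 * α) ≤ r := by linarith only [hBA, hr]
  have hgrad : B * (α + 11 * (4 : ℝ) ^ 2 * α) +
      2 * (α ^ 2 + 226 * (8 * ((4 : ℝ) + 1) * ((4 : ℝ) + 4)) ^ 2 * (α ^ 2) ^ 2) * r ≤ r := by
    nlinarith only [hBA, hXs, hX0, hr]
  have hℓ : B * (α + 11 * (4 : ℝ) ^ 2 * α) +
      16 * (α ^ 2 + 226 * (8 * ((4 : ℝ) + 1) * ((4 : ℝ) + 4)) ^ 2 * (α ^ 2) ^ 2) * (B * (α + 11 * (4 : ℝ) ^ 2 * α)) ≤ r := by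
    nlinarith only [hBA, hXs, hX0, hBA0, hr]
  -- the proviso at the chosen bundle
  have hreg : InEndRegime (ne3OfRecord₁₁ F ⟨Nper, α / 2, 0, g, constOfRecord N F.L Nper g, r,
      Bh * (α + 11 * (4 : ℝ) ^ 2 * α) +
        8 * (α ^ 2 + 226 * (8 * ((4 : ℝ) + 1) * ((4 : ℝ) + 4)) ^ 2 * (α ^ 2) ^ 2) * (B * (α + 11 * (4 : ℝ) ^ 2 * α)), dom⟩) := by
    refine (inEndRegime_ne3Objects_iff F _).2 ⟨hN, hg, by positivity, ?_, hr.le, hr_def ▸ le_rfl, le_rfl, by positivity, le_rfl⟩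
    change α / 2 ≤ radiusOfRecord N F.L Nper
    rw [← hr_def]; linarith only [hαr, hα]
  refine ⟨α / 2, constOfRecord N F.L Nper g, r,
    Bh * (α + 11 * (4 : ℝ) ^ 2 * α) + 8 * (α ^ 2 + 226 * (8 * ((4 : ℝ) + 1) * ((4 : ℝ) + 4)) ^ 2 * (α ^ 2) ^ 2) * (B * (α + 11 * (4 : ℝ) ^ 2 * α)),
    α ^ 2, α ^ 2, by positivity, by positivity, hreg, fun hT hP h3 => ?_⟩
  exact ⟨fun _ => 1, c₁, c₁', B₁', cP, C₂, B₀β, inp, B, Bh, α ^ 2, α ^ 2, α, 0, 1, fun _ => ∅, fun _ _ => le_rfl, fun _ => rfl, hB₁', hBB,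
    hB_def, hBh_def, h16, hwin, by positivity, by positivity, hRb, hcF, hα, hA3, hA2, hAs, hAc, hXα, hY, le_rfl, by linarith only [hXs],
    fun _ _ hq => hq.elim, by linarith only [hXs], by change α / 2 < α; linarith only [hα], hss, hgrad, hℓ, le_rfl, hT, hP, h3⟩

end

end Summit.QuantumFields.YangMills.BalabanUVNodes.N16LeafSlotLetters
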